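import Literature.Probability.RandomPlanarGeometry.HullHausdorffKernel
import Literature.Probability.RandomPlanarGeometry.HalfPlaneFillProofs
import Literature.Probability.RandomPlanarGeometry.StarHullExtension
import HarnessLib

/-!
# Continuity of the half-plane capacity under Hausdorff convergence (Kemppainen–Smirnov, Lemma A.2)

Topic `Literature/Probability/RandomPlanarGeometry` (family `crit-ising`); theorems only, no
definition and no named fact. Continuation of `HullHausdorffKernel.lean` (the Carathéodory
kernel theorem for hydrodynamically normalized maps of half-plane hulls that converge in the
Hausdorff sense).

A. Kemppainen, S. Smirnov, *Random curves, scaling limits and Loewner evolutions*, Ann. Probab.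
45 (2017), App. A, Lemma A.2 (arXiv:1212.6215, Lemma 5.3): "If `γ_n → γ` uniformly, then
`g_{n,t} → g_t` uniformly on `S_K(T, δ)`. **Especially `hcap γ_n[0, ·] → hcap γ[0, ·]`**". This
capacity convergence is the input `υ_n → υ` of the main lemma (Lemma A.4/A.5) constructing the
Loewner chain of a limit of simple curves; everything else of that lemma is in the tree
(`Loewner.isGeneratedByCurve_of_tendstoLocallyUniformly'`, `SLETraceEightKernel.lean`).
Results:

* `IsBoundedHull.image_add_real` — real translates of bounded hulls are bounded hulls;
* `IsStarHull.exists_isHydrodynamicMap`, **`IsBoundedHull.exists_isHydrodynamicMap`**,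
  `exists_isHydrodynamicMap_hpFill` — EXISTENCE of the hydrodynamically normalized map
  `g_A : ℍ ∖ A → ℍ` (Lawler (2005), Prop. 3.36) for every bounded hull, in particular for the
  fill `hpFill S` of a closed bounded set attached to the lower half-plane (the hull "related
  to" a curve from a real point): for a `*`-hull `g_A = Φ_A - L_A` with the tree's restriction
  map `Φ_A` (`IsStarHull.existsUnique_isRestrictionMap_holds`) and hydrodynamic constant
  `L_A = hullShift Φ_A` (`tendsto_hullExt_sub_self`); a general bounded hull is first translated
  off the origin;
* **`tendsto_hcap_of_thickening`** — under the hypotheses of the kernel theorem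
  (`S_n, S ⊆ B̄(0, R)`, `ℍ ∖ K_n`, `ℍ ∖ K` the unbounded components of `ℍ ∖ S_n`, `ℍ ∖ S`,
  hydrodynamic maps `g_n, g`, and `S_n → S` in the Hausdorff sense), **`hcap K_n → hcap K`**:
  the inverted reflected maps `f_n(w) = ĝ_n(1/w) - 1/w` (`invertAt ∘ reflExt`,
  `HydrodynamicExpansion`, `HydrodynamicMaps`) are holomorphic on `|w| < 1/(2R)` and bounded by
  `576 R` there, converge on the lower half-disc by the kernel theorem, hence locally uniformly
  on the whole disc (Montel and the identity theorem), so `f_n'(0) = hcap K_n` converges;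
* `tendsto_hcap_image_Icc_of_tendstoUniformlyOn` — **Lemma A.2 for curves**: if
  `γ_n → γ` uniformly on `[0, t]` (curves in `ℍ̄`), then `hcap` of the hulls of `γ_n[0, t]`
  tends to `hcap` of the hull of `γ[0, t]`, for any choice of the hulls and hydrodynamic maps;
  and `exists_isHydrodynamicMap_hpFill_image_Icc` provides them for a curve from a real point.

## References

* A. Kemppainen, S. Smirnov, Ann. Probab. 45 (2017), App. A, Lemma A.2 (arXiv:1212.6215,
  Lemma 5.3). [KemppainenSmirnov2017]
* G. F. Lawler, *Conformally Invariant Processes in the Plane*, AMS (2005), §3.4 Prop. 3.36,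
  Def. 3.37, (3.12), Prop. 3.46. [Lawler2005]
* Ch. Pommerenke, *Boundary Behaviour of Conformal Maps*, Springer (1992), Thm. 1.8.
  [PommerenkeBBCM1992]
-/

noncomputable section

open Set Filter Topology Metric Bornology Complex Function
open UpperHalfPlane (upperHalfPlaneSet isOpen_upperHalfPlaneSet)
open Literature.Analysis.Complex

namespace Literature.Probability.RandomPlanarGeometry

/-! ### Existence of the hydrodynamically normalized map -/

/-- **Real translates of bounded hulls are bounded hulls.** [folklore] -/
theorem IsBoundedHull.image_add_real {K : Set ℂ} (hK : IsBoundedHull K) (c : ℝ) :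
    IsBoundedHull ((fun z : ℂ ↦ z + (c : ℂ)) '' K) := by
  set T : ℂ ≃ₜ ℂ := Homeomorph.addRight (c : ℂ) with hT
  have hTc : ⇑T = fun z : ℂ ↦ z + (c : ℂ) := rfl
  have himage : ∀ s : Set ℂ, (fun z : ℂ ↦ z + (c : ℂ)) '' s = {w | w - (c : ℂ) ∈ s} := by
    intro s
    ext w
    simp only [mem_image, mem_setOf_eq]
    constructor
    · rintro ⟨z, hz, rfl⟩
      rwa [add_sub_cancel_right]
    · intro hw
      exact ⟨w - c, hw, sub_add_cancel w c⟩
  have hinter : (fun z : ℂ ↦ z + (c : ℂ)) '' K ∩ upperHalfPlaneSet =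
      (fun z : ℂ ↦ z + (c : ℂ)) '' (K ∩ upperHalfPlaneSet) := by
    rw [himage, himage]
    ext w
    simp only [mem_inter_iff, mem_setOf_eq]
    have : (w - (c : ℂ)).im = w.im := by simp
    change _ ∧ 0 < w.im ↔ _ ∧ 0 < (w - (c : ℂ)).im
    rw [this]
  have hdiff : upperHalfPlaneSet \ (fun z : ℂ ↦ z + (c : ℂ)) '' K =
      (fun z : ℂ ↦ z + (c : ℂ)) '' (upperHalfPlaneSet \ K) := by
    rw [himage, himage]
    ext w
    simp only [Set.mem_sdiff, mem_setOf_eq]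
    have : (w - (c : ℂ)).im = w.im := by simp
    change 0 < w.im ∧ _ ↔ 0 < (w - (c : ℂ)).im ∧ _
    rw [this]
  refine ⟨(hK.isCompact.image (continuous_add_const _)).isBounded, ?_, ?_⟩
  · rw [hinter, ← hTc, ← T.image_closure, hK.2.1]
  · rw [hdiff, ← hTc]
    exact T.isSimplyConnected_image.2 hK.2.2

/-- **The hydrodynamically normalized map of a `*`-hull exists**: `g_A = Φ_A - L_A` with the
restriction map `Φ_A` (`IsStarHull.existsUnique_isRestrictionMap_holds`) and the hydrodynamic
constant `L_A` (`hullShift`, `tendsto_hullExt_sub_self`). (Lawler (2005), Prop. 3.36; [LSW] §2: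
`Φ_A = g_A - g_A(0)`.) [cite: Lawler2005, §3.4 Prop. 3.36] -/
theorem IsStarHull.exists_isHydrodynamicMap {K : Set ℂ} (hK : IsStarHull K) :
    ∃ φ : ConformalEquiv (upperHalfPlaneSet \ K) upperHalfPlaneSet, IsHydrodynamicMap K φ := by
  obtain ⟨Φ, hΦ, -⟩ := IsStarHull.existsUnique_isRestrictionMap_holds hK
  set L : ℂ := hullShift Φ with hL
  have hLim : L.im = 0 := hullShift_im hK.isBoundedHull hΦ
  have hLre : ((L.re : ℝ) : ℂ) = L := Complex.ext (by simp) (by simp [hLim])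
  refine ⟨Φ.trans (addRealUpperHalfPlane (-L.re)), ?_⟩
  change Tendsto (fun z ↦ (Φ.trans (addRealUpperHalfPlane (-L.re))) z - z)
    (cocompact ℂ ⊓ 𝓟 (upperHalfPlaneSet \ K)) (𝓝 0)
  have h1 := (tendsto_hullExt_sub_self hK.isBoundedHull hΦ).mono_left
    (inf_le_left (b := 𝓟 (upperHalfPlaneSet \ K)))
  have h2 := h1.sub_const L
  rw [sub_self] at h2
  refine h2.congr' ?_
  filter_upwards [mem_inf_of_right (mem_principal_self _)] with z hz
  rw [ConformalEquiv.trans_apply, addRealUpperHalfPlane_apply, hullExt_of_mem_diff hz, ofReal_neg,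
    hLre]
  ring

/-- **The hydrodynamically normalized map `g_A : ℍ ∖ A → ℍ` exists for every bounded hull**
(`A ∈ 𝒬`: bounded, the closure of its part in `ℍ`, `ℍ ∖ A` simply connected) — Lawler (2005),
Prop. 3.36 ("For each `A ∈ 𝒬` there is a unique conformal transformation `g_A` …"), here by
translating `A` off the origin and using the `*`-hull case. [cite: Lawler2005, §3.4 Prop. 3.36] -/
theorem IsBoundedHull.exists_isHydrodynamicMap {K : Set ℂ} (hK : IsBoundedHull K) :
    ∃ φ : ConformalEquiv (upperHalfPlaneSet \ K) upperHalfPlaneSet, IsHydrodynamicMap K φ := by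
  obtain ⟨R₀, hR₀⟩ := hK.isCompact.isBounded.subset_closedBall 0
  set c : ℝ := |R₀| + 1 with hc
  have hc0 : 0 < c := by positivity
  set K' : Set ℂ := (fun z : ℂ ↦ z + (c : ℂ)) '' K with hK'def
  have hK' : IsBoundedHull K' := hK.image_add_real c
  have h0 : (0 : ℂ) ∉ K' := by
    rintro ⟨z, hz, hz0⟩
    have h1 : ‖z‖ ≤ R₀ := by simpa using hR₀ hz
    have h2 : z = -(c : ℂ) := eq_neg_of_add_eq_zero_left hz0
    rw [h2, norm_neg, Complex.norm_real, Real.norm_eq_abs, abs_of_pos hc0] at h1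
    linarith [le_abs_self R₀]
  obtain ⟨φ', hφ'⟩ := IsStarHull.exists_isHydrodynamicMap ⟨hK', h0⟩
  -- the translation `ℍ ∖ K → ℍ ∖ K'`
  have hmem : ∀ {z : ℂ}, z ∈ upperHalfPlaneSet \ K ↔ z + (c : ℂ) ∈ upperHalfPlaneSet \ K' := by
    intro z
    simp only [Set.mem_sdiff, hK'def]
    have him : (z + (c : ℂ)).im = z.im := by simp
    change 0 < z.im ∧ _ ↔ 0 < (z + (c : ℂ)).im ∧ _
    rw [him]
    refine and_congr Iff.rfl ⟨fun hz ⟨y, hy, hyz⟩ ↦ hz (by rwa [← add_right_cancel hyz]), ?_⟩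
    intro hz hzK
    exact hz ⟨z, hzK, rfl⟩
  have hTbij : BijOn (fun z : ℂ ↦ z + (c : ℂ)) (upperHalfPlaneSet \ K) (upperHalfPlaneSet \ K') := by
    refine ⟨fun z hz ↦ hmem.1 hz, fun z _ z' _ h ↦ add_right_cancel h, fun w hw ↦ ?_⟩
    refine ⟨w - c, hmem.2 ?_, sub_add_cancel w c⟩
    rwa [sub_add_cancel]
  have hTd : DifferentiableOn ℂ (fun z : ℂ ↦ z + (c : ℂ)) (upperHalfPlaneSet \ K) :=
    differentiableOn_id.add_const _
  have hTinv : DifferentiableOn ℂ (invFunOn (fun z : ℂ ↦ z + (c : ℂ)) (upperHalfPlaneSet \ K))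
      (upperHalfPlaneSet \ K') := by
    refine (differentiableOn_id.sub_const (c : ℂ)).congr fun w hw ↦ ?_
    have h := hTbij.invOn_invFunOn.2 hw
    simp only at h
    simp only [id_eq]
    exact eq_sub_of_add_eq h
  set T : ConformalEquiv (upperHalfPlaneSet \ K) (upperHalfPlaneSet \ K') :=
    ConformalEquiv.ofBijOn _ hTd hTbij hTinv with hTdef
  refine ⟨T.trans (φ'.trans (addRealUpperHalfPlane (-c))), ?_⟩
  change Tendsto (fun z ↦ (T.trans (φ'.trans (addRealUpperHalfPlane (-c)))) z - z)
    (cocompact ℂ ⊓ 𝓟 (upperHalfPlaneSet \ K)) (𝓝 0)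
  have hT_tend : Tendsto (fun z : ℂ ↦ z + (c : ℂ)) (cocompact ℂ ⊓ 𝓟 (upperHalfPlaneSet \ K))
      (cocompact ℂ ⊓ 𝓟 (upperHalfPlaneSet \ K')) := by
    refine tendsto_inf.2 ⟨tendsto_cocompact_of_norm_sub_self_le (C := ‖(c : ℂ)‖) inf_le_left
      (Eventually.of_forall fun z ↦ by rw [add_sub_cancel_left]), tendsto_principal.2 ?_⟩
    filter_upwards [mem_inf_of_right (mem_principal_self _)] with z hz using hTbij.mapsTo hz
  have h1 := Tendsto.comp (show Tendsto _ _ _ from hφ') hT_tend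
  refine h1.congr' (Eventually.of_forall fun z ↦ ?_)
  simp only [comp_apply, hTdef, ConformalEquiv.trans_apply, ConformalEquiv.ofBijOn_apply,
    addRealUpperHalfPlane_apply, ofReal_neg]
  ring

/-- **The hydrodynamic map of the fill of an attached closed bounded set exists.** For `S`
closed and bounded with `S ∪ {im ≤ 0}` connected, the fill `hpFill S` (Lawler–Schramm–Werner's
`Fill_ℍ`, `HalfPlaneFill.lean`) is a bounded hull (`isBoundedHull_hpFill`), so it carries a
hydrodynamically normalized map, and `ℍ ∖ hpFill S` is the unbounded component of `ℍ ∖ S`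
(`diff_hpFill`). [cite: Lawler2005, §3.4 Prop. 3.36] -/
theorem exists_isHydrodynamicMap_hpFill {S : Set ℂ} (hS : IsClosed S) (hSb : IsBounded S)
    (hconn : IsConnected (S ∪ {z : ℂ | z.im ≤ 0})) :
    ∃ φ : ConformalEquiv (upperHalfPlaneSet \ hpFill S) upperHalfPlaneSet,
      IsHydrodynamicMap (hpFill S) φ :=
  (isBoundedHull_hpFill isSimplyConnected_of_isConnected_compl_holds hS hSb hconn).exists_isHydrodynamicMap

/-! ### Convergence of the half-plane capacity -/

section Capacity

variable {S K : Set ℂ} {φ : ConformalEquiv (upperHalfPlaneSet \ K) upperHalfPlaneSet}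
  {Sn Kn : ℕ → Set ℂ} {φn : ∀ n, ConformalEquiv (upperHalfPlaneSet \ Kn n) upperHalfPlaneSet}
  {R : ℝ}

/-- **Kemppainen–Smirnov's Lemma A.2, capacity form: `hcap K_n → hcap K`** under Hausdorff
convergence of the generating sets. Let `S_n, S ⊆ B̄(0, R)`, `ℍ ∖ K_n`, `ℍ ∖ K` the unbounded
components of `ℍ ∖ S_n`, `ℍ ∖ S`, `g_n : ℍ ∖ K_n → ℍ`, `g : ℍ ∖ K → ℍ` hydrodynamically
normalized, and for every `ε > 0` eventually `S_n ⊆ S^ε` and `S ⊆ S_n^ε`. Then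
`hcap K_n → hcap K`. Proof: the inverted reflected maps `f_n(w) = ĝ_n(1/w) - 1/w` are
holomorphic on `|w| < 1/(2R)`, bounded by `576 R`, and converge on the lower half-disc (the
kernel theorem `tendstoLocallyUniformlyOn_of_thickening` at the points `1/w ∈ ℍ`, `|1/w| > 2R`);
by Montel's theorem and the identity theorem they converge locally uniformly on the disc, so
`f_n'(0) = hcap K_n → f'(0) = hcap K`. [cite: KemppainenSmirnov2017, App. A Lemma A.2]
[cite: Lawler2005, §3.4 Def. 3.37] -/
theorem tendsto_hcap_of_thickening (hR : 0 < R)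
    (hSR : S ⊆ closedBall (0 : ℂ) R) (hSnR : ∀ n, Sn n ⊆ closedBall (0 : ℂ) R)
    (hV : upperHalfPlaneSet \ K = Loewner.unboundedComponent (upperHalfPlaneSet \ S))
    (hVn : ∀ n, upperHalfPlaneSet \ Kn n = Loewner.unboundedComponent (upperHalfPlaneSet \ Sn n))
    (hφ : IsHydrodynamicMap K φ) (hφn : ∀ n, IsHydrodynamicMap (Kn n) (φn n))
    (h1 : ∀ ε > 0, ∀ᶠ n in atTop, Sn n ⊆ thickening ε S)
    (h2 : ∀ ε > 0, ∀ᶠ n in atTop, S ⊆ thickening ε (Sn n)) :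
    Tendsto (fun n ↦ hcap (Kn n) (φn n)) atTop (𝓝 (hcap K φ)) := by
  have hKR : K ∩ upperHalfPlaneSet ⊆ closedBall ((0 : ℝ) : ℂ) R :=
    inter_subset_closedBall_of_diff_eq hSR hV
  have hKnR : ∀ n, Kn n ∩ upperHalfPlaneSet ⊆ closedBall ((0 : ℝ) : ℂ) R := fun n ↦
    inter_subset_closedBall_of_diff_eq (hSnR n) (hVn n)
  -- the reflected maps and their inversions at `∞`
  set G : ℕ → ℂ → ℂ := fun n ↦ IsHydrodynamicMap.reflExt (φn n) with hG
  set Gl : ℂ → ℂ := IsHydrodynamicMap.reflExt φ with hGl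
  have hGn : ∀ n, IsHydrodynamicAt (G n) 0 R := fun n ↦ (hφn n).isHydrodynamicAt_reflExt (hKnR n) hR
  have hGli : IsHydrodynamicAt Gl 0 R := hφ.isHydrodynamicAt_reflExt hKR hR
  have hcapn : ∀ n, hcap (Kn n) (φn n) = hcapAt (G n) 0 := fun n ↦ (hφn n).hcap_eq_hcapAt (hKnR n) hR
  have hcapl : hcap K φ = hcapAt Gl 0 := hφ.hcap_eq_hcapAt hKR hR
  set F : ℕ → ℂ → ℂ := fun n ↦ invertAt (G n) 0 with hF
  set Fl : ℂ → ℂ := invertAt Gl 0 with hFl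
  -- the disc `U = B(0, 1/(2R))`
  set U : Set ℂ := ball (0 : ℂ) (2 * R)⁻¹ with hU
  have hUo : IsOpen U := isOpen_ball
  have hUsub : U ⊆ ball (0 : ℂ) R⁻¹ := ball_subset_ball (by
    rw [inv_le_inv₀ (by positivity) hR]; linarith)
  have hFd : ∀ n, DifferentiableOn ℂ (F n) U := fun n ↦ (hGn n).differentiableOn_invertAt.mono hUsub
  have hFld : DifferentiableOn ℂ Fl U := hGli.differentiableOn_invertAt.mono hUsub
  -- points of `U ∖ {0}` invert to `|z| > 2R`
  have hinvU : ∀ {w : ℂ}, w ∈ U → w ≠ 0 → 2 * R < ‖w⁻¹‖ := by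
    intro w hw hw0
    rw [hU, mem_ball_zero_iff] at hw
    rw [norm_inv, lt_inv_comm₀ (by positivity) (norm_pos_iff.2 hw0)]
    exact hw
  -- `G_n = g_n` on the upper far region, which lies in `ℍ ∖ K_n`; the images have `im > 0`
  have hnn : ∀ n, ∀ z : ℂ, R < ‖z - (0 : ℝ)‖ → 0 < z.im → 0 ≤ (G n z).im := fun n z hz hzi ↦ by
    have hzK := IsHydrodynamicMap.mem_diff_of_lt (hKnR n) hz hzi
    change 0 ≤ (IsHydrodynamicMap.reflExt (φn n) z).im
    rw [IsHydrodynamicMap.reflExt_eq hzK]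
    exact (IsHydrodynamicMap.im_pos hzK).le
  -- uniform bound `|F_n| ≤ 576 R` on `U`
  have hFb : ∀ n, ∀ w ∈ U, ‖F n w‖ ≤ 576 * R := by
    intro n w hw
    rcases eq_or_ne w 0 with rfl | hw0
    · simp only [hF, IsHydrodynamicAt.invertAt_zero, norm_zero]
      positivity
    · have h2R := hinvU hw hw0
      have hb := (hGn n).norm_sub_self_le_of_im_nonneg (hnn n) (z := w⁻¹)
        (by rw [ofReal_zero, sub_zero]; exact h2R.le)
      simp only [hF]
      rw [IsHydrodynamicAt.invertAt_of_ne hw0, ofReal_zero, zero_add, sub_zero]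
      exact hb
  -- pointwise convergence on the lower half of `U`
  have hmaps := tendstoLocallyUniformlyOn_of_thickening hR hSR hSnR hV hVn hφ hφn h1 h2
  have hpt : ∀ w ∈ U, w.im < 0 → Tendsto (fun n ↦ F n w) atTop (𝓝 (Fl w)) := by
    intro w hw hwi
    have hw0 : w ≠ 0 := by
      intro h; rw [h, zero_im] at hwi; exact lt_irrefl _ hwi
    set z : ℂ := w⁻¹ with hz
    have hzi : 0 < z.im := by
      rw [hz, inv_im, neg_div, Left.neg_pos_iff, div_neg_iff]
      exact Or.inr ⟨hwi, Complex.normSq_pos.2 hw0⟩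
    have hzR : R < ‖z - (0 : ℝ)‖ := by
      rw [ofReal_zero, sub_zero]
      linarith [hinvU hw hw0]
    have hzK : z ∈ upperHalfPlaneSet \ K := IsHydrodynamicMap.mem_diff_of_lt hKR hzR hzi
    have hzKn : ∀ n, z ∈ upperHalfPlaneSet \ Kn n := fun n ↦
      IsHydrodynamicMap.mem_diff_of_lt (hKnR n) hzR hzi
    have hconv : Tendsto (fun n ↦ φn n z) atTop (𝓝 (φ z)) := hmaps.tendsto_at hzK
    have hFn : ∀ n, F n w = φn n z - z := fun n ↦ by
      simp only [hF]
      rw [IsHydrodynamicAt.invertAt_of_ne hw0, ofReal_zero, zero_add, sub_zero, ← hz]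
      change IsHydrodynamicMap.reflExt (φn n) z - z = _
      rw [IsHydrodynamicMap.reflExt_eq (hzKn n)]
    have hFlw : Fl w = φ z - z := by
      simp only [hFl]
      rw [IsHydrodynamicAt.invertAt_of_ne hw0, ofReal_zero, zero_add, sub_zero, ← hz]
      change IsHydrodynamicMap.reflExt φ z - z = _
      rw [IsHydrodynamicMap.reflExt_eq hzK]
    simp only [hFn, hFlw]
    exact hconv.sub_const z
  -- Montel and the identity theorem: `F_n → Fl` locally uniformly on `U`
  have hw₀U : (-(((4 * R)⁻¹ : ℝ) : ℂ) * I) ∈ U := by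
    rw [hU, mem_ball_zero_iff, norm_mul, norm_neg, norm_I, mul_one, Complex.norm_real,
      Real.norm_of_nonneg (by positivity)]
    rw [inv_lt_inv₀ (by positivity) (by positivity)]
    linarith
  have hw₀im : (-(((4 * R)⁻¹ : ℝ) : ℂ) * I).im < 0 := by
    simp only [neg_mul, neg_im, mul_im, ofReal_re, I_im, mul_one, ofReal_im, I_re, mul_zero,
      add_zero, Left.neg_neg_iff]
    positivity
  have hlim : TendstoLocallyUniformlyOn F Fl atTop U := by
    refine tendstoLocallyUniformlyOn_of_forall_strictMono hUo fun ψ hψ ↦ ?_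
    obtain ⟨Fs, σ, hσ, hFsd, hFslim, -⟩ :=
      Complex.exists_strictMono_tendstoLocallyUniformlyOn_of_norm_le hUo
        (F := fun k ↦ F (ψ k)) (M := 576 * R) (fun k ↦ hFd (ψ k)) (fun k w hw ↦ hFb _ w hw)
    -- `Fs = Fl` on the lower half of `U`, hence on `U`
    have hlow : ∀ w ∈ U, w.im < 0 → Fs w = Fl w := fun w hw hwi ↦
      tendsto_nhds_unique (hFslim.tendsto_at hw)
        (((hpt w hw hwi).comp hψ.tendsto_atTop).comp hσ.tendsto_atTop)
    have hopen : IsOpen (U ∩ {w : ℂ | w.im < 0}) :=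
      hUo.inter (isOpen_lt continuous_im continuous_const)
    have hev : Fs =ᶠ[𝓝 (-(((4 * R)⁻¹ : ℝ) : ℂ) * I)] Fl :=
      eventuallyEq_of_mem (hopen.mem_nhds ⟨hw₀U, hw₀im⟩) fun w hw ↦ hlow w hw.1 hw.2
    have heq : EqOn Fs Fl U :=
      (hFsd.analyticOnNhd hUo).eqOn_of_preconnected_of_eventuallyEq (hFld.analyticOnNhd hUo)
        (convex_ball _ _).isPreconnected hw₀U hev
    exact ⟨σ, hσ, hFslim.congr_right heq⟩
  -- derivatives at `0` converge
  have hderiv := hlim.deriv (Eventually.of_forall hFd) hUo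
  have h0U : (0 : ℂ) ∈ U := mem_ball_self (by positivity)
  have hd0 : Tendsto (fun n ↦ deriv (F n) 0) atTop (𝓝 (deriv Fl 0)) := hderiv.tendsto_at h0U
  have hd0' : Tendsto (fun n ↦ ((hcap (Kn n) (φn n) : ℝ) : ℂ)) atTop (𝓝 ((hcap K φ : ℝ) : ℂ)) := by
    have e1 : ∀ n, deriv (F n) 0 = ((hcap (Kn n) (φn n) : ℝ) : ℂ) := fun n ↦ by
      rw [hcapn n]; exact (hGn n).deriv_invertAt_eq
    have e2 : deriv Fl 0 = ((hcap K φ : ℝ) : ℂ) := by rw [hcapl]; exact hGli.deriv_invertAt_eq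
    simp only [e1, e2] at hd0
    exact hd0
  have h := (continuous_re.tendsto ((hcap K φ : ℝ) : ℂ)).comp hd0'
  simp only [Function.comp_def, ofReal_re] at h
  exact h

end Capacity

/-! ### Lemma A.2 for curves -/

section Curves

variable {γn : ℕ → ℝ → ℂ} {γ : ℝ → ℂ} {t : ℝ}

/-- Uniform convergence of curves on `[0, t]` gives both halves of the Hausdorff convergence of
the traces `γ_n[0, t] → γ[0, t]`. [folklore] -/
theorem eventually_image_Icc_subset_thickening (hlim : TendstoUniformlyOn γn γ atTop (Icc 0 t))
    {ε : ℝ} (hε : 0 < ε) :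
    ∀ᶠ n in atTop, γn n '' Icc 0 t ⊆ thickening ε (γ '' Icc 0 t) ∧
      γ '' Icc 0 t ⊆ thickening ε (γn n '' Icc 0 t) := by
  filter_upwards [(Metric.tendstoUniformlyOn_iff.1 hlim) ε hε] with n hn
  constructor
  · rintro _ ⟨s, hs, rfl⟩
    exact mem_thickening_iff.2 ⟨γ s, ⟨s, hs, rfl⟩, by rw [dist_comm]; exact hn s hs⟩
  · rintro _ ⟨s, hs, rfl⟩
    exact mem_thickening_iff.2 ⟨γn n s, ⟨s, hs, rfl⟩, hn s hs⟩

/-- **Kemppainen–Smirnov's Lemma A.2: "if `γ_n → γ` uniformly, then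
`hcap γ_n[0, t] → hcap γ[0, t]`".** Let `γ_n → γ` uniformly on `[0, t]`, and let `K_n`, `K`
be hulls with `ℍ ∖ K_n`, `ℍ ∖ K` the unbounded components of `ℍ ∖ γ_n[0, t]`, `ℍ ∖ γ[0, t]`
(the hulls "related to" the traces), carrying hydrodynamically normalized maps `g_n`, `g`
(which exist for curves in `ℍ̄` from a real point, `exists_isHydrodynamicMap_hpFill_image_Icc`).
Then `hcap K_n → hcap K`. [cite: KemppainenSmirnov2017, App. A Lemma A.2] -/
theorem tendsto_hcap_image_Icc_of_tendstoUniformlyOn (hγ : ContinuousOn γ (Icc 0 t))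
    (hlim : TendstoUniformlyOn γn γ atTop (Icc 0 t))
    {Kn : ℕ → Set ℂ} {K : Set ℂ}
    {φn : ∀ n, ConformalEquiv (upperHalfPlaneSet \ Kn n) upperHalfPlaneSet}
    {φ : ConformalEquiv (upperHalfPlaneSet \ K) upperHalfPlaneSet}
    (hVn : ∀ n, upperHalfPlaneSet \ Kn n =
      Loewner.unboundedComponent (upperHalfPlaneSet \ γn n '' Icc 0 t))
    (hV : upperHalfPlaneSet \ K = Loewner.unboundedComponent (upperHalfPlaneSet \ γ '' Icc 0 t))
    (hφn : ∀ n, IsHydrodynamicMap (Kn n) (φn n)) (hφ : IsHydrodynamicMap K φ) :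
    Tendsto (fun n ↦ hcap (Kn n) (φn n)) atTop (𝓝 (hcap K φ)) := by
  -- a common bound, valid from some index on
  obtain ⟨R₀, hR₀⟩ := ((isCompact_Icc.image_of_continuousOn hγ).isBounded).subset_closedBall 0
  set R : ℝ := |R₀| + 1 with hR
  have hR0 : 0 < R := by positivity
  have hSR : γ '' Icc 0 t ⊆ closedBall (0 : ℂ) R := hR₀.trans (closedBall_subset_closedBall (by
    rw [hR]; linarith [le_abs_self R₀]))
  obtain ⟨N, hN⟩ := eventually_atTop.1 ((Metric.tendstoUniformlyOn_iff.1 hlim) 1 one_pos)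
  have hSnR : ∀ n, γn (n + N) '' Icc 0 t ⊆ closedBall (0 : ℂ) R := by
    rintro n _ ⟨s, hs, rfl⟩
    have h1 : ‖γ s‖ ≤ R₀ := by simpa using hR₀ ⟨s, hs, rfl⟩
    have h2 : dist (γ s) (γn (n + N) s) < 1 := hN (n + N) (Nat.le_add_left N n) s hs
    rw [mem_closedBall_zero_iff]
    rw [dist_eq_norm] at h2
    have h3 := norm_sub_norm_le (γn (n + N) s) (γ s)
    rw [norm_sub_rev] at h3
    rw [hR]
    linarith [le_abs_self R₀]
  -- the kernel theorem for the shifted sequence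
  have hlim' : TendstoUniformlyOn (fun n ↦ γn (n + N)) γ atTop (Icc 0 t) := fun u hu ↦
    (tendsto_add_atTop_nat N).eventually (hlim u hu)
  have key := tendsto_hcap_of_thickening (Kn := fun n ↦ Kn (n + N)) (φn := fun n ↦ φn (n + N))
    hR0 hSR hSnR hV (fun n ↦ hVn (n + N)) hφ (fun n ↦ hφn (n + N))
    (fun ε hε ↦ (eventually_image_Icc_subset_thickening hlim' hε).mono fun n hn ↦ hn.1)
    (fun ε hε ↦ (eventually_image_Icc_subset_thickening hlim' hε).mono fun n hn ↦ hn.2)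
  exact (tendsto_add_atTop_iff_nat N).1 key

/-- **The hull of an initial segment of a curve from a real point, and its hydrodynamic map.**
For `γ` continuous on `[0, t]` (`0 ≤ t`) with `im γ(0) = 0`, the fill
`K = hpFill γ[0, t]` carries a hydrodynamically normalized map and `ℍ ∖ K` is the unbounded
component of `ℍ ∖ γ[0, t]` — the hull `K_t` and the map `g_t` "related to `γ[0, t]`" of
Kemppainen–Smirnov's Lemma A.2 (Lawler (2005), §4.1: the hulls generated by a curve).
[cite: KemppainenSmirnov2017, App. A Lemma A.2] [cite: Lawler2005, §3.4 Prop. 3.36] -/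
theorem exists_isHydrodynamicMap_hpFill_image_Icc (ht : 0 ≤ t) (hγ : ContinuousOn γ (Icc 0 t))
    (h0 : (γ 0).im = 0) :
    ∃ φ : ConformalEquiv (upperHalfPlaneSet \ hpFill (γ '' Icc 0 t)) upperHalfPlaneSet,
      IsHydrodynamicMap (hpFill (γ '' Icc 0 t)) φ ∧
      upperHalfPlaneSet \ hpFill (γ '' Icc 0 t) =
        Loewner.unboundedComponent (upperHalfPlaneSet \ γ '' Icc 0 t) := by
  have hSc : IsCompact (γ '' Icc 0 t) := isCompact_Icc.image_of_continuousOn hγ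
  have hS : IsClosed (γ '' Icc 0 t) := hSc.isClosed
  have hSb : IsBounded (γ '' Icc 0 t) := hSc.isBounded
  have hconn : IsConnected (γ '' Icc 0 t ∪ {z : ℂ | z.im ≤ 0}) := by
    have h1 : IsConnected (γ '' Icc 0 t) := (isConnected_Icc ht).image _ hγ
    have h2 : IsConnected {z : ℂ | z.im ≤ 0} :=
      (convex_halfSpace_im_le 0).isConnected ⟨0, by simp⟩
    have h0s : γ 0 ∈ γ '' Icc 0 t := ⟨0, ⟨le_rfl, ht⟩, rfl⟩
    have h0l : γ 0 ∈ {z : ℂ | z.im ≤ 0} := by simp [h0]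
    exact IsConnected.union ⟨γ 0, h0s, h0l⟩ h1 h2
  obtain ⟨φ, hφ⟩ := exists_isHydrodynamicMap_hpFill hS hSb hconn
  exact ⟨φ, hφ, diff_hpFill hS hSb⟩

end Curves

end Literature.Probability.RandomPlanarGeometry
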